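import Literature.NumberTheory.DiophantineGeometry.MultiplicativeGroupApproximationProofs
import Mathlib.LinearAlgebra.Matrix.Rank
import Mathlib.LinearAlgebra.Matrix.NonsingularInverse
import Mathlib.Algebra.Order.BigOperators.Ring.Finset
import HarnessLib

/-!
# Small multiplicative relations among rational numbers

If non-zero rationals `α₁, …, αₙ` are multiplicatively dependent, then they satisfy a relation
`∏ αₖ^{mₖ} = 1` whose exponents are controlled by the heights: on a *minimal* dependent set `S`
of indices, `|mₖ| ≤ 2 ∏_{l ∈ S ∖ {k}} (2 h(α_l) / log 2)` (`exists_small_mult_relation`). This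
is the elementary case `K = ℚ` of the bounds of Loxton–van der Poorten / Matveev for small
multiplicative relations in number fields, with a crude but explicit constant; it is what the
reduction of Baker-type theorems to multiplicatively independent arguments consumes (e.g. Yu's
reduction of his `p`-adic theorem, Yu 1999, Lemma 15.1).

Proof (all folklore linear algebra): the valuation vectors `(ord_q αₖ)_q` are `ℚ`-linearly
dependent; on a minimal dependent set of columns one column is a `ℚ`-combination of the others,
which are independent; a non-singular square row-submatrix exists (row rank = column rank,
`exists_rows_det_ne_zero`); Cramer's rule produces an integer kernel vector whose entries are
determinants (`exists_int_kernel_vector`), each bounded by Hadamard's inequality in the `ℓ¹` form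
`|det M| ≤ ∏ⱼ ∑ᵢ |M_{ij}|` (`abs_det_le_prod_sum_abs`); finally `∑_q |ord_q α| ≤ 2 h(α) / log 2`
(`sum_abs_padicValRat_le`) and a rational with zero valuation vector is `±1`, so doubling the
exponents gives an exact relation.

No definition and no named fact is introduced; everything is a theorem.
-/

noncomputable section

open Finset Matrix Height

namespace Literature.NumberTheory.DiophantineGeometry.Dioph

/-- **Hadamard's inequality, elementary `ℓ¹` form.** `|det M| ≤ ∏ⱼ ∑ᵢ |M i j|` (expand the
determinant; the permutations are among all maps `n → n`). [folklore] -/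
theorem abs_det_le_prod_sum_abs {n : Type*} [Fintype n] [DecidableEq n] {R : Type*} [CommRing R]
    [LinearOrder R] [IsStrictOrderedRing R] (M : Matrix n n R) :
    |M.det| ≤ ∏ j, ∑ i, |M i j| := by
  rw [Matrix.det_apply]
  calc |∑ σ : Equiv.Perm n, Equiv.Perm.sign σ • ∏ i, M (σ i) i|
      ≤ ∑ σ : Equiv.Perm n, |Equiv.Perm.sign σ • ∏ i, M (σ i) i| :=
        Finset.abs_sum_le_sum_abs _ _
    _ = ∑ σ : Equiv.Perm n, ∏ i, |M (σ i) i| := by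
        refine Finset.sum_congr rfl fun σ _ => ?_
        rw [← Finset.abs_prod]
        rcases Int.units_eq_one_or (Equiv.Perm.sign σ) with h | h <;> rw [h]
        · rw [one_smul]
        · rw [Units.neg_smul, one_smul, abs_neg]
    _ = ∑ f ∈ (univ : Finset (Equiv.Perm n)).image (fun σ : Equiv.Perm n => (σ : n → n)),
          ∏ i, |M (f i) i| := by
        rw [Finset.sum_image (fun (σ : Equiv.Perm n) _ (τ : Equiv.Perm n) _ (h : (σ : n → n) = τ) =>
          Equiv.ext (congrFun h))]
    _ ≤ ∑ f : n → n, ∏ i, |M (f i) i| :=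
        Finset.sum_le_sum_of_subset_of_nonneg (subset_univ _)
          (fun f _ _ => Finset.prod_nonneg fun i _ => abs_nonneg _)
    _ = ∏ j, ∑ i, |M i j| := by
        rw [Finset.prod_univ_sum (fun _ => (univ : Finset n)) (fun j i => |M i j|)]
        simp only [Fintype.piFinset_univ]


/-- **Row selection.** A matrix over `ℚ` with linearly independent columns has a square row
submatrix (an injective selection of `|cols|` rows) with non-zero determinant (row rank = column
rank). [folklore] -/
theorem exists_rows_det_ne_zero {ρ ι' : Type*} [Fintype ρ] [Fintype ι'] [DecidableEq ι']
    (Aq : Matrix ρ ι' ℚ) (hind : LinearIndependent ℚ Aq.col) :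
    ∃ f : ι' → ρ, Function.Injective f ∧ (Matrix.of fun i j => Aq (f i) j).det ≠ 0 := by
  classical
  obtain ⟨κ₀, a, ha, hspan, hli⟩ := exists_linearIndependent' (K := ℚ) Aq.row
  letI : Fintype κ₀ := Fintype.ofInjective a ha
  have hcard : Fintype.card κ₀ = Fintype.card ι' := by
    have h1 := finrank_span_eq_card (R := ℚ) hli
    have h2 : Aq.rank = Fintype.card ι' := by
      rw [Matrix.rank_eq_finrank_span_cols, finrank_span_eq_card hind]
    have h3 := Matrix.rank_eq_finrank_span_row Aq
    rw [hspan] at h1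
    omega
  let e : ι' ≃ κ₀ := Fintype.equivOfCardEq hcard.symm
  refine ⟨a ∘ e, ha.comp e.injective, ?_⟩
  have hrows : LinearIndependent ℚ (Matrix.of fun i j => Aq ((a ∘ e) i) j).row := by
    have : (Matrix.of fun i j => Aq ((a ∘ e) i) j).row = (Aq.row ∘ a) ∘ e := by
      funext i j; rfl
    rw [this]
    exact hli.comp e e.injective
  have hU := Matrix.linearIndependent_rows_iff_isUnit.mp hrows
  rw [Matrix.isUnit_iff_isUnit_det, isUnit_iff_ne_zero] at hU
  exact hU

/-- Sum over an injective selection of rows is at most the full sum (non-negative terms).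
[folklore] -/
theorem sum_comp_le_sum_of_injective {ρ ι' : Type*} [Fintype ρ] [Fintype ι'] {f : ι' → ρ}
    (hf : Function.Injective f) (g : ρ → ℤ) (hg : ∀ r, 0 ≤ g r) :
    ∑ i, g (f i) ≤ ∑ r, g r := by
  classical
  have : ∑ i, g (f i) = ∑ r ∈ (univ : Finset ι').map ⟨f, hf⟩, g r := by
    rw [Finset.sum_map]; rfl
  rw [this]
  exact Finset.sum_le_sum_of_subset_of_nonneg (subset_univ _) fun r _ _ => hg r

/-- **Integer kernel vector by Cramer's rule, with Hadamard bounds.** Let `A` be an integer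
`ρ × ι` matrix, `S` a set of columns and `s₀ ∈ S` such that the columns in `S ∖ {s₀}` are
linearly independent over `ℚ` and column `s₀` lies in their `ℚ`-span. Then there is an integer
vector `t` supported in `S` with `t_{s₀} ≠ 0`, `∑ᵢ tᵢ A_{r i} = 0` for every row `r`, and
`|tᵢ| ≤ ∏_{l ∈ S ∖ {i}} ∑_r |A_{r l}|` (Cramer's rule on a non-singular square row-submatrix;
each Cramer determinant is bounded by Hadamard's `ℓ¹` inequality). [folklore] -/
theorem exists_int_kernel_vector {ρ ι : Type*} [Fintype ρ] [Fintype ι] [DecidableEq ι]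
    (A : ρ → ι → ℤ) (S : Finset ι) {s₀ : ι} (hs₀ : s₀ ∈ S)
    (hind : LinearIndepOn ℚ (fun i => fun r => (A r i : ℚ)) ↑(S.erase s₀))
    (hspan : (fun r => (A r s₀ : ℚ)) ∈
      Submodule.span ℚ ((fun i => fun r => (A r i : ℚ)) '' ↑(S.erase s₀))) :
    ∃ t : ι → ℤ, t s₀ ≠ 0 ∧ (∀ i ∉ S, t i = 0) ∧ (∀ r, ∑ i, t i * A r i = 0) ∧
      ∀ i, |t i| ≤ ∏ l ∈ S.erase i, ∑ r, |A r l| := by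
  classical
  -- the independent columns, as a type
  set ι' := {i // i ∈ S.erase s₀} with hι'
  set Aq : Matrix ρ ι' ℚ := Matrix.of fun r i => (A r i.val : ℚ) with hAq
  have hcol : LinearIndependent ℚ Aq.col := hind
  obtain ⟨f, hf, hdet⟩ := exists_rows_det_ne_zero Aq hcol
  -- the integer square matrix and Cramer vector
  set B : Matrix ι' ι' ℤ := Matrix.of fun i j => A (f i) j.val with hB
  set b : ι' → ℤ := fun i => A (f i) s₀ with hb
  set x : ι' → ℤ := B.cramer b with hx
  have hBq : (Matrix.of fun i j => Aq (f i) j) = B.map (Int.castRingHom ℚ) := by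
    ext i j; rfl
  have hdetB : B.det ≠ 0 := by
    intro h0
    apply hdet
    rw [hBq, ← RingHom.mapMatrix_apply, ← RingHom.map_det, h0, map_zero]
  have hBx : B.mulVec x = B.det • b := Matrix.mulVec_cramer B b
  -- the coefficient vector over ℚ and uniqueness
  obtain ⟨c, hc⟩ : ∃ c : ι' → ℚ, ∑ i, c i • (fun r => (A r i.val : ℚ)) = fun r => (A r s₀ : ℚ) := by
    rw [Set.image_eq_range] at hspan
    exact Submodule.mem_span_range_iff_exists_fun ℚ |>.mp hspan
  have hc' : ∀ r, ∑ i, c i * (A r i.val : ℚ) = A r s₀ := by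
    intro r
    have := congrFun hc r
    simpa only [Finset.sum_apply, Pi.smul_apply, smul_eq_mul] using this
  have hxc : ∀ i, (x i : ℚ) = B.det * c i := by
    -- both `x` and `det • c` solve `Bq v = det • bq`; `Bq` is injective
    have hinj : Function.Injective (B.map (Int.castRingHom ℚ)).mulVec := by
      rw [Matrix.mulVec_injective_iff_isUnit, Matrix.isUnit_iff_isUnit_det, isUnit_iff_ne_zero,
        ← hBq]
      exact hdet
    have h1 : (B.map (Int.castRingHom ℚ)).mulVec (fun i => (x i : ℚ)) =
        fun i => ((B.det : ℤ) : ℚ) * (b i : ℚ) := by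
      funext i
      have := congrFun hBx i
      simp only [Matrix.mulVec, dotProduct, Pi.smul_apply, smul_eq_mul] at this ⊢
      simp only [Matrix.map_apply, Int.coe_castRingHom]
      exact_mod_cast this
    have h2 : (B.map (Int.castRingHom ℚ)).mulVec (fun i => (B.det : ℚ) * c i) =
        fun i => ((B.det : ℤ) : ℚ) * (b i : ℚ) := by
      funext i
      simp only [Matrix.mulVec, dotProduct, Matrix.map_apply, Int.coe_castRingHom, hB, hb,
        Matrix.of_apply]
      rw [← hc' (f i), Finset.mul_sum]
      refine Finset.sum_congr rfl fun j _ => ?_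
      ring
    have := hinj (h1.trans h2.symm)
    intro i
    exact congrFun this i
  -- the kernel vector
  set t : ι → ℤ := fun i => if hi : i ∈ S.erase s₀ then x ⟨i, hi⟩ else if i = s₀ then -B.det else 0
    with htdef
  have hts₀ : t s₀ = -B.det := by
    show (if hi : s₀ ∈ S.erase s₀ then x ⟨s₀, hi⟩ else if s₀ = s₀ then -B.det else 0) = -B.det
    rw [dif_neg (by simp), if_pos rfl]
  have htS : ∀ i ∉ S, t i = 0 := by
    intro i hi
    have h1 : i ∉ S.erase s₀ := fun h => hi (Finset.mem_of_mem_erase h)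
    have h2 : i ≠ s₀ := fun h => hi (h ▸ hs₀)
    show (if hi : i ∈ S.erase s₀ then x ⟨i, hi⟩ else if i = s₀ then -B.det else 0) = 0
    rw [dif_neg h1, if_neg h2]
  have htι' : ∀ i : ι', t i.val = x i := fun i => by
    show (if hi : i.val ∈ S.erase s₀ then x ⟨i.val, hi⟩ else if i.val = s₀ then -B.det else 0) = x i
    rw [dif_pos i.2]
  -- `Finset` bookkeeping between `ι'` and `S.erase s₀`
  set emb : ι' ↪ ι := ⟨Subtype.val, Subtype.val_injective⟩ with hemb
  have hmapuniv : (univ : Finset ι').map emb = S.erase s₀ := by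
    ext l
    simp only [Finset.mem_map, Finset.mem_univ, true_and, hemb, Function.Embedding.coeFn_mk]
    constructor
    · rintro ⟨a, rfl⟩; exact a.2
    · intro hl; exact ⟨⟨l, hl⟩, rfl⟩
  have hsumval : ∀ g : ι → ℤ, ∑ j : ι', g j.val = ∑ l ∈ S.erase s₀, g l := by
    intro g
    have h := Finset.sum_map (univ : Finset ι') emb g
    rw [hmapuniv] at h
    exact h.symm
  have hprodval : ∀ g : ι → ℤ, ∏ j : ι', g j.val = ∏ l ∈ S.erase s₀, g l := by
    intro g
    have h := Finset.prod_map (univ : Finset ι') emb g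
    rw [hmapuniv] at h
    exact h.symm
  have hsumt : ∀ g : ι → ℤ, ∑ i, t i * g i = -B.det * g s₀ + ∑ i : ι', x i * g i.val := by
    intro g
    rw [← Finset.sum_subset (Finset.subset_univ S) (fun i _ hi => by rw [htS i hi, zero_mul]),
      ← Finset.add_sum_erase S _ hs₀, hts₀]
    congr 1
    rw [← hsumval (fun l => t l * g l)]
    exact Finset.sum_congr rfl fun i _ => by rw [htι']
  -- column sums of `B` and of `b` are bounded by the full column sums of `A`
  set N : ι → ℤ := fun l => ∑ r, |A r l| with hN
  have hN0 : ∀ l, 0 ≤ N l := fun l => Finset.sum_nonneg fun r _ => abs_nonneg _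
  have hcolB : ∀ j : ι', ∑ i : ι', |B i j| ≤ N j.val := fun j =>
    sum_comp_le_sum_of_injective hf (fun r => |A r j.val|) fun r => abs_nonneg _
  have hcolb : ∑ i : ι', |b i| ≤ N s₀ :=
    sum_comp_le_sum_of_injective hf (fun r => |A r s₀|) fun r => abs_nonneg _
  refine ⟨t, by rw [hts₀]; exact neg_ne_zero.mpr hdetB, htS, ?_, ?_⟩
  · -- the relation on every row
    intro r
    rw [hsumt]
    have h1 : ((∑ i : ι', x i * A r i.val : ℤ) : ℚ) = ((B.det * A r s₀ : ℤ) : ℚ) := by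
      simp only [Int.cast_sum, Int.cast_mul]
      rw [← hc' r, Finset.mul_sum]
      refine Finset.sum_congr rfl fun i _ => ?_
      rw [hxc i]; ring
    rw [Int.cast_injective h1]; ring
  · -- the Hadamard bounds
    intro i
    by_cases hiS : i ∈ S
    swap
    · rw [htS i hiS, abs_zero]
      exact Finset.prod_nonneg fun l _ => hN0 l
    by_cases his : i = s₀
    · subst his
      rw [hts₀, abs_neg]
      calc |B.det| ≤ ∏ j, ∑ i', |B i' j| := abs_det_le_prod_sum_abs B
        _ ≤ ∏ j : ι', N j.val := Finset.prod_le_prod (fun j _ => Finset.sum_nonneg fun _ _ =>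
            abs_nonneg _) fun j _ => hcolB j
        _ = ∏ l ∈ S.erase i, N l := hprodval N
    · have hi' : i ∈ S.erase s₀ := Finset.mem_erase.mpr ⟨his, hiS⟩
      have hti : t i = x ⟨i, hi'⟩ := htι' ⟨i, hi'⟩
      rw [hti, hx, Matrix.cramer_apply]
      set G : ι' → ℤ := fun j => if j = ⟨i, hi'⟩ then N s₀ else N j.val with hG
      calc |(B.updateCol ⟨i, hi'⟩ b).det|
          ≤ ∏ j, ∑ i', |(B.updateCol ⟨i, hi'⟩ b) i' j| := abs_det_le_prod_sum_abs _
        _ ≤ ∏ j, G j := by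
          refine Finset.prod_le_prod (fun j _ => Finset.sum_nonneg fun _ _ => abs_nonneg _)
            fun j _ => ?_
          by_cases hj : j = ⟨i, hi'⟩
          · subst hj
            simp only [Matrix.updateCol_self, hG, if_true]
            exact hcolb
          · simp only [Matrix.updateCol_ne hj, hG, hj, if_false]
            exact hcolB j
        _ = N s₀ * ∏ j ∈ univ.erase (⟨i, hi'⟩ : ι'), N j.val := by
          rw [← Finset.mul_prod_erase univ G (Finset.mem_univ ⟨i, hi'⟩)]
          congr 1
          · simp [hG]
          · exact Finset.prod_congr rfl fun j hj => by
              rw [Finset.mem_erase] at hj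
              simp [hG, hj.1]
        _ = N s₀ * ∏ l ∈ (S.erase s₀).erase i, N l := by
          congr 1
          have h := Finset.prod_map (univ.erase (⟨i, hi'⟩ : ι')) emb N
          rw [Finset.map_erase, hmapuniv] at h
          exact h.symm
        _ = ∏ l ∈ S.erase i, N l := by
          rw [Finset.erase_right_comm, Finset.mul_prod_erase (S.erase i) N
            (Finset.mem_erase.mpr ⟨Ne.symm his, hs₀⟩)]


/-- **A minimal linearly dependent subfamily.** A linearly dependent finite family has a finite
set `S` of indices, dependent but with all proper subsets independent; for any `s₀ ∈ S` the
vectors indexed by `S ∖ {s₀}` are independent and span `v s₀`. [folklore] -/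
theorem exists_minimal_linearDepOn {ι : Type*} [Fintype ι] [DecidableEq ι] {V : Type*}
    [AddCommGroup V] [Module ℚ V] (v : ι → V) (hdep : ¬ LinearIndependent ℚ v) :
    ∃ (S : Finset ι) (s₀ : ι), s₀ ∈ S ∧ (∀ T : Finset ι, T ⊂ S → LinearIndepOn ℚ v ↑T) ∧
      LinearIndepOn ℚ v ↑(S.erase s₀) ∧ v s₀ ∈ Submodule.span ℚ (v '' ↑(S.erase s₀)) := by
  classical
  set D := (univ : Finset ι).powerset.filter (fun T : Finset ι => ¬ LinearIndepOn ℚ v (↑T : Set ι))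
    with hD
  have huniv : (univ : Finset ι) ∈ D := by
    rw [hD, Finset.mem_filter]
    refine ⟨Finset.mem_powerset.mpr subset_rfl, ?_⟩
    rwa [Finset.coe_univ, linearIndepOn_univ_iff]
  obtain ⟨S, hSD, hSmin⟩ := Finset.exists_min_image D Finset.card ⟨_, huniv⟩
  have hSdep : ¬ LinearIndepOn ℚ v (↑S : Set ι) := (Finset.mem_filter.mp hSD).2
  have hmin : ∀ T : Finset ι, T ⊂ S → LinearIndepOn ℚ v ↑T := by
    intro T hT
    by_contra hTdep
    have hTD : T ∈ D := Finset.mem_filter.mpr ⟨Finset.mem_powerset.mpr (subset_univ _), hTdep⟩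
    exact absurd (Finset.card_lt_card hT) (not_lt.mpr (hSmin T hTD))
  have hSne : S.Nonempty := by
    rw [Finset.nonempty_iff_ne_empty]
    rintro rfl
    exact hSdep (by simp)
  obtain ⟨s₀, hs₀⟩ := hSne
  have hind : LinearIndepOn ℚ v ↑(S.erase s₀) := hmin _ (Finset.erase_ssubset hs₀)
  refine ⟨S, s₀, hs₀, hmin, hind, ?_⟩
  by_contra hspan
  apply hSdep
  have : (↑S : Set ι) = insert s₀ ↑(S.erase s₀) := by
    rw [← Finset.coe_insert, Finset.insert_erase hs₀]
  rw [this, linearIndepOn_insert (by simp)]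
  exact ⟨hind, hspan⟩

/-- `∑_q |ord_q y| ≤ 2 h(y) / log 2` for a `P`-unit `y` (`q` over `P`): from
`h(y) = ½ (|∑ ord_q(y) log q| + ∑ |ord_q(y)| log q)` and `log q ≥ log 2`. [folklore] -/
theorem sum_abs_padicValRat_le {P : Finset ℕ} (hP : ∀ p ∈ P, p.Prime) {y : ℚ}
    (hy : IsPUnit P y) :
    ∑ q : P, |(padicValRat q y : ℝ)| ≤ 2 * logHeight₁ y / Real.log 2 := by
  have hl2 : 0 < Real.log 2 := Real.log_pos one_lt_two
  rw [le_div_iff₀ hl2, logHeight₁_eq_heightSeminorm_padicOrdVec hP hy, heightSeminorm_apply]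
  have h1 : ∑ q : P, |(padicValRat q y : ℝ)| * Real.log 2 ≤
      ∑ q : P, |padicOrdVec P y q| * Real.log q := by
    apply Finset.sum_le_sum
    intro q _
    apply mul_le_mul_of_nonneg_left _ (abs_nonneg _)
    exact Real.log_le_log two_pos (by exact_mod_cast (hP q q.2).two_le)
  rw [Finset.sum_mul]
  linarith [abs_nonneg (∑ q : P, padicOrdVec P y q * Real.log q)]

/-- **Small multiplicative relations over `ℚ`.** If non-zero rationals `αₖ ∉ {±1}` are
multiplicatively dependent, then there are a non-empty set `S` of indices and an integer vector
`t` with support exactly `S` such that `∏ αₖ^{2tₖ} = 1` and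
`|tₖ| ≤ ∏_{l ∈ S ∖ {k}} (2 h(α_l) / log 2)` for `k ∈ S` (an elementary substitute, over `ℚ`,
for the Loxton–van der Poorten bound: a minimal dependent set of valuation vectors, Cramer's
rule and Hadamard's inequality, and `∑_q |ord_q α| ≤ 2h(α)/log 2`). [folklore] -/
theorem exists_small_mult_relation {κ : Type*} [Fintype κ] [DecidableEq κ] {α : κ → ℚ}
    (h0 : ∀ k, α k ≠ 0) {m : κ → ℤ} (hm : m ≠ 0) (hrel : ∏ k, α k ^ m k = 1) :
    ∃ (S : Finset κ) (t : κ → ℤ), S.Nonempty ∧ (∀ k, t k ≠ 0 ↔ k ∈ S) ∧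
      ∏ k, α k ^ (2 * t k) = 1 ∧
      ∀ k ∈ S, (|t k| : ℝ) ≤ ∏ l ∈ S.erase k, (2 * logHeight₁ (α l) / Real.log 2) := by
  classical
  -- a finite set of primes outside which every `αₖ` is a unit
  set M := (univ : Finset κ).sup (fun k => max (α k).num.natAbs (α k).den) + 1 with hM
  set P := Nat.primesBelow M with hPdef
  have hP : ∀ p ∈ P, p.Prime := fun p hp => (Nat.mem_primesBelow.mp hp).2
  have hunit : ∀ k, IsPUnit P (α k) := by
    intro k
    have hk : max (α k).num.natAbs (α k).den ≤
        (univ : Finset κ).sup (fun k => max (α k).num.natAbs (α k).den) :=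
      Finset.le_sup (f := fun k => max (α k).num.natAbs (α k).den) (Finset.mem_univ k)
    have hk1 : (α k).num.natAbs ≤ max (α k).num.natAbs (α k).den := le_max_left _ _
    have hk2 : (α k).den ≤ max (α k).num.natAbs (α k).den := le_max_right _ _
    apply isPUnit_primesBelow (h0 k) <;> omega
  -- the integer valuation matrix (rows `↥P`, columns `κ`) and the column relation
  set A : P → κ → ℤ := fun q k => padicValRat q (α k) with hA
  have hrelA : ∀ q : P, ∑ k, m k * A q k = 0 := by
    intro q
    have h := congrFun (padicOrdVec_prod_zpow (P := P) hP h0 m) q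
    rw [hrel, padicOrdVec_one] at h
    simp only [Pi.zero_apply, Finset.sum_apply, Pi.smul_apply] at h
    simp only [zsmul_eq_mul, padicOrdVec] at h
    exact_mod_cast h.symm
  set v : κ → (P → ℚ) := fun k q => (A q k : ℚ) with hv
  have hvsum : ∀ (g : κ → ℤ), (∀ q : P, ∑ k, g k * A q k = 0) →
      ∑ k, (g k : ℚ) • v k = 0 := by
    intro g hg
    funext q
    simp only [Finset.sum_apply, Pi.smul_apply, smul_eq_mul, hv, Pi.zero_apply]
    exact_mod_cast hg q
  have hdep : ¬ LinearIndependent ℚ v := by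
    rw [Fintype.linearIndependent_iff]
    push Not
    obtain ⟨k₁, hk₁⟩ := Function.ne_iff.mp hm
    have hk₁' : m k₁ ≠ 0 := hk₁
    refine ⟨fun k => (m k : ℚ), hvsum m hrelA, k₁, ?_⟩
    show ((m k₁ : ℤ) : ℚ) ≠ 0
    exact_mod_cast hk₁'
  obtain ⟨S, s₀, hs₀, hmin, hind, hspan⟩ := exists_minimal_linearDepOn v hdep
  obtain ⟨t, hts₀, htS, htrel, htbd⟩ := exists_int_kernel_vector A S hs₀ hind hspan
  -- the support of `t` is exactly `S` (minimality)
  have hsupp : ∀ k, t k ≠ 0 ↔ k ∈ S := by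
    intro k
    constructor
    · intro h
      by_contra hk
      exact h (htS k hk)
    · intro hk htk
      have hks : k ≠ s₀ := fun h => hts₀ (h ▸ htk)
      have hT := hmin (S.erase k) (Finset.erase_ssubset hk)
      have hzero : ∀ i, i ∉ S.erase k → (t i : ℚ) • v i = 0 := by
        intro i hi
        have : t i = 0 := by
          by_cases hiS : i ∈ S
          · have : i = k := by
              by_contra hik
              exact hi (Finset.mem_erase.mpr ⟨hik, hiS⟩)
            rw [this, htk]
          · exact htS i hiS
        rw [this, Int.cast_zero, zero_smul]
      have hsum : ∑ i : ↥(S.erase k), (t i.val : ℚ) • v i.val = 0 := by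
        rw [Finset.sum_coe_sort (S.erase k) (fun i => (t i : ℚ) • v i),
          Finset.sum_subset (Finset.subset_univ _) (fun i _ hi => hzero i hi)]
        exact hvsum t htrel
      have hli := Fintype.linearIndependent_iff.mp hT (fun i => (t i.val : ℚ)) hsum
        ⟨s₀, Finset.mem_erase.mpr ⟨fun h => hks h.symm, hs₀⟩⟩
      exact hts₀ (by exact_mod_cast hli)
  -- the multiplicative relation
  have hone : ∏ k, α k ^ (2 * t k) = 1 := by
    have hy : padicOrdVec P (∏ k, α k ^ t k) = 0 := by
      rw [padicOrdVec_prod_zpow hP h0 t]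
      funext q
      simp only [Finset.sum_apply, Pi.smul_apply, Pi.zero_apply]
      simp only [zsmul_eq_mul, padicOrdVec]
      exact_mod_cast htrel q
    have hu : IsPUnit P (∏ k, α k ^ t k) :=
      IsPUnit.prod _ fun k _ => (hunit k).zpow _
    have hsq : ∏ k, α k ^ (2 * t k) = (∏ k, α k ^ t k) ^ (2 : ℤ) := by
      rw [← Finset.prod_zpow]
      refine Finset.prod_congr rfl fun k _ => ?_
      rw [← _root_.zpow_mul, mul_comm]
    rw [hsq]
    rcases eq_sign_of_padicOrdVec_eq_zero hP hu hy with h | h <;> rw [h] <;> norm_num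
  refine ⟨S, t, ⟨s₀, hs₀⟩, hsupp, hone, fun k hk => ?_⟩
  -- the bound
  have hN : ∀ l, ((∑ q : P, |A q l| : ℤ) : ℝ) ≤ 2 * logHeight₁ (α l) / Real.log 2 := by
    intro l
    have := sum_abs_padicValRat_le hP (hunit l)
    push_cast [hA]
    exact this
  calc (|t k| : ℝ) = ((|t k| : ℤ) : ℝ) := (Int.cast_abs).symm
    _ ≤ ((∏ l ∈ S.erase k, ∑ q : P, |A q l| : ℤ) : ℝ) := by exact_mod_cast htbd k
    _ = ∏ l ∈ S.erase k, ((∑ q : P, |A q l| : ℤ) : ℝ) := by push_cast; rfl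
    _ ≤ ∏ l ∈ S.erase k, (2 * logHeight₁ (α l) / Real.log 2) :=
        Finset.prod_le_prod (fun l _ => by positivity) fun l _ => hN l

end Literature.NumberTheory.DiophantineGeometry.Dioph

end
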